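import Summits.BirchSwinnertonDyer.BirchSwinnertonDyer.Theses.ResidualThetaTransportAtTwo
import Summits.BirchSwinnertonDyer.BirchSwinnertonDyer.Theorems.ResidualThetaTransportAtTwoThetaLayerLambdaCongruenceAtTwoCosocleKanPlus
import HarnessLib

/-!
# Line `birth` for crux `ThetaLayerLambdaCongruenceAtTwo` (stmt-BirchSwinnertonDyer-20688, route ResidualThetaTransportAtTwo) —
# skeleton v14 (LEAD bsd-wall-rtt-p3 g12, 2026-08-28T17:2xZ; = width seat w3 g10's proposed v14′ ADOPTED verbatim): ONE stub, the
# CURVE-LEVEL COSOCLE STATEMENT (Galois-free, pairing-free), DECISION-AGNOSTIC w.r.t. the typing of Buzzard's Prop. 2.4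

History. v1 (planner p2 g8/g9, `ebcedd75615b74a2`) → … → v13 (lead g10/g11/g12, `3820413dc2cd5167`: {stub_heckeSelfDual = SD item 27800,
stub_buzzard = Bz item 27798}, `_of := thetaLayerLambdaCongruenceAtTwo_of_sdBz`) → v14 (this file). WHY v14: the crux meets print at EXACTLY ONE
statement about the tree's own objects — for `W/ℚ` globally minimal with `GoodSS W 2`, every odd level `L` with all `p ∤ 2L` good, and every
maximal `𝔪 ∋ 2` of `𝕋 = HeckeRing0 L 2` with `|𝕋/𝔪| = 2` and `T_q − a_q(W) ∈ 𝔪` (`q ∤ L`): `dim_{𝕋/𝔪} Λ/𝔪Λ = 2`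
(`Λ = periodHomologyHecke L = H₁(X₀(L); ℤ)`; «cosocle multiplicity one at the mod-2 eigen-ideals», hypothesis `hcosW`). LANDED roads:
* `thetaLayerLambdaCongruenceAtTwo_of_cosocleW : hcosW → Kan⁺` (w3 g10, `…CosocleKanPlus`, p649433; FLAT from the CLOSED node 27436);
* `cosocleW_of_aliasInputs h27800 h27798 : hcosW` (w3 g10, `…CosocleOfSelfDual`, p651011: SD ∧ Bz ⟹ hcosW — so v14 is never worse than v13
  under the CURRENT, Albanese-coordinate typing of Buzzard), and `cosocleAtEigenIdeal_of_cosocleFact h : hcosW` from Buzzard Prop. 2.4 read on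
  its printed PICARD carrier `J[2] = Hom(Λ, ℤ/2)` (spelled inline; review p648238: mathematics confirmed, «replacement, not addition»; INPUTS print
  reading 17:07Z and pen 16:38Z concur) — under that typing item 27800 (SD) and the intersection-pairing port leave the closing path;
* converse bridge `finrank_torsionBySet_eq_two_of_cosocle_of_sd` (lead g12, `…SocleOfCosocle`, p650638: socle ⟸ cosocle + SD) for the tree's three
  socle consumers if the ONE fact is re-typed; execution sequence in Lines/birth-buzzard-typing-execution.md (g12).
So the SKELETON no longer depends on which coordinate the programme keeps for the one vendored Buzzard fact (director ruling pending), and the SAME stub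
is the target of the kernel road (w2 g8's SD₂ architecture + Bz: bricks S1 ✓ w2 g8 / w4 g6, S2–S7 open).
STUB (1 ≤ stubs_max; PRINT-LEVEL — never a bare prover target; closes by `cosocleW_of_aliasInputs` today):
  (COS) `stub_cosocleMultOne : hcosW`.
BSD is not proved by this; nothing in this file is a theorem of the tree (the stub is `sorry`); Kan⁺ stays CONDITIONAL on published facts
(SD ∧ Bz as typed today; Bz alone under the Picard typing) and is NOT settled.

References: [Buzzard2000LevelLoweringModTwo] Prop. 2.4, Def. 2.1–2.2; [RibetStein2008] §2.3.1.1, App. (Conrad) Def. 5.6; [DarmonDiamondTaylor1995]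
§1.3, §1.6 Lemma 1.38, §4.5 Thm. 4.26; [Pollack2003] Conj. 6.3, Prop. 6.18; [GreenbergVatsal2000] §1 (10), §3 (13).
-/

set_option autoImplicit false
-- justification: the `Summit.BirchSwinnertonDyer.BirchSwinnertonDyer.…` path repeats a component (route-file convention)
set_option linter.dupNamespace false

noncomputable section

open scoped MatrixGroups ModularForm NumberField
open CongruenceSubgroup Polynomial IsDedekindDomain Rat.HeightOneSpectrum
  Literature.NumberTheory.EllipticCurves.Rank1Residual Literature.NumberTheory.EllipticCurves.ModularForms
  Summit.BirchSwinnertonDyer.BirchSwinnertonDyer.Theses.ResidualThetaTransportAtTwo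

namespace Summit.BirchSwinnertonDyer.BirchSwinnertonDyer.Cruxes.ThetaLayerLambdaCongruenceAtTwo.Birth

/-- (COS) PRINT-LEVEL STUB — cosocle multiplicity one at the mod-`2` eigen-ideals of good-supersingular-at-`2` curves at odd levels:
`dim_{𝕋/𝔪} Λ/𝔪Λ = 2`. = hypothesis `hcosW` of `thetaLayerLambdaCongruenceAtTwo_of_cosocleW`. Discharges: `cosocleW_of_aliasInputs h27800 h27798`
(items 27800 ∧ 27798 as typed) or `cosocleAtEigenIdeal_of_cosocleFact h` (Buzzard Prop. 2.4 read on `J[2] = Hom(Λ, ℤ/2)`). Never a research target.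
[cite: Buzzard2000LevelLoweringModTwo, Prop. 2.4 and Def. 2.1–2.2 (p. 100–101)] [cite: DarmonDiamondTaylor1995, §4.5 Thm. 4.26 (pp. 133–134)] -/
theorem stub_cosocleMultOne :
    ∀ (W : WeierstrassCurve ℚ) [W.IsElliptic] [W.IsGloballyMinimal], GoodSS W 2 →
      ∀ (L : ℕ) [NeZero L], Odd L →
      (∀ v : HeightOneSpectrum (𝓞 ℚ), ¬ ((primesEquiv v : ℕ) ∣ 2 * L) → W.HasGoodReductionAt v) →
      ∀ (𝔪 : Ideal (HeckeRing0 L 2)), 𝔪.IsMaximal → (2 : HeckeRing0 L 2) ∈ 𝔪 → Nat.card (HeckeRing0 L 2 ⧸ 𝔪) = 2 →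
      (∀ (q : ℕ) (hq : q.Prime), ¬ q ∣ L → HeckeRing0.T L 2 q hq - (W.LFunction q : HeckeRing0 L 2) ∈ 𝔪) →
      Module.finrank (HeckeRing0 L 2 ⧸ 𝔪)
        (periodHomologyHecke L ⧸ (𝔪 • ⊤ : Submodule (HeckeRing0 L 2) (periodHomologyHecke L))) = 2 := by
  sorry

/-- THE SKELETON THEOREM (registrar shape): the crux BY NAME from the ONE stub through the LANDED sorry-free road
`thetaLayerLambdaCongruenceAtTwo_of_cosocleW` (p649433). [cite: Pollack2003, Conj. 6.3 and Prop. 6.18] -/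
theorem ThetaLayerLambdaCongruenceAtTwo_of :
    Summit.BirchSwinnertonDyer.BirchSwinnertonDyer.Theses.ResidualThetaTransportAtTwo.ThetaLayerLambdaCongruenceAtTwo :=
  Summit.BirchSwinnertonDyer.BirchSwinnertonDyer.Theorems.ThetaLayerLambdaCongruenceAtTwo.thetaLayerLambdaCongruenceAtTwo_of_cosocleW
    stub_cosocleMultOne

end Summit.BirchSwinnertonDyer.BirchSwinnertonDyer.Cruxes.ThetaLayerLambdaCongruenceAtTwo.Birth

end
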